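import Literature.AlgebraicGeometry.Frobenioids.DivisorMonoidCategoryTheoreticityCorProofsII
import Literature.AlgebraicGeometry.Frobenioids.BaseDegSquare
import Literature.AlgebraicGeometry.Frobenioids.BaseDivRigidity
import Literature.AlgebraicGeometry.Frobenioids.RigiditySlimness
import HarnessLib

/-!
# Frobenioids I, Corollaries 4.11 (ii), (iv)-rigid, 4.12 — INSTANCES for Frobenioids `C_i → F_{Φ_i}`

Mochizuki, *The geometry of Frobenioids I: the general theory*, Kyushu J. Math. **62** (2008)
293–400, kurims text Cor. 4.11, 4.12 pp. 91–95 [cite: MochizukiFrdI2008, Cor. 4.11 (ii) p.91].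

PROOF-ONLY companion of `DivisorMonoidCategoryTheoreticity.lean` (seat abc-iut-L1-t3, v2). The generic
reductions of `BaseSquareUniqueness.lean`, `BaseDegSquare.lean`, `BaseDivRigidity.lean` take as hypotheses
Def. 1.3 (i)(a)(b)(c), (ii), (iv)(b) in operations form and the rigidity of `C₂ → D₂` (Prop. 1.13 (i)); for
Frobenioids (`IsFrobenioid`, `ofFunctor`) these are THEOREMS (`RigiditySlimness.lean`, seat abc-iut-L1-t1,
and the extraction lemmas below), whence:

* `exists_linear_preSteps_of_base_iso`, `exists_linear_arrow_over_base`, `exists_baseIso_of_degFr`: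
  Def. 1.3 (i)(b), (i)(c)+(iv)(b), (ii) of a Frobenioid in operations form (pre-steps and pull-back
  morphisms are linear; morphisms of Frobenius type are base-isomorphisms of prescribed degree);
* `cor411ii_of_exists_base_equivalence'`: the typed Cor. 4.11 (ii) for Frobenioids follows from the mere
  EXISTENCE of an equivalence `Ψ^Base` with `Base₂ ∘ Ψ ≅ Ψ^Base ∘ Base₁` (1-uniqueness and rigidity being
  automatic);
* `cor412_of_base_square'`, `cor412_of_cor411ii`: the typed Cor. 4.12 for Frobenioids from such a base
  square (resp. from the typed Cor. 4.11 (ii) under its hypotheses) and "`Ψ` preserves Frobenius degrees";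
* `cor411ivRigid_of_square`: the typed `Cor411ivRigid` (v2; print's rigidity clause of Cor. 4.11 (iv),
  "each of the composite functors [`C₁ → F_{Φ₂}`] of this diagram is rigid", p. 92, via the Div-slimness
  argument of p. 93) for THE `Ψ^Base`, `Ψ^Φ` of a base square compatible with divisors (the data produced by
  Cor. 4.11 (ii)–(iv)) — UNCONDITIONAL given that data.

No statement of the paper is strengthened; nothing here is specific to the abc programme.
-/

namespace Literature.AlgebraicGeometry.Frobenioids

open CategoryTheory Opposite

universe w v v' u u'

namespace PreFrobenioid

section OneFrobenioid

variable {D : Type u} [Category.{v} D] {Φ : Dᵒᵖ ⥤ CommMonCat.{w}} {C : Type u'} [Category.{v'} C]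
  (F : C ⥤ ElemFrobenioid Φ)

/-- Def. 1.3 (i)(b) in operations form, with the linearity of pre-steps recorded: every base-isomorphism
`g : Base A ≅ Base B` is `Base(ψ) ∘ Base(φ)⁻¹` for LINEAR `φ : X → A`, `ψ : X → B` with `Base(φ)` invertible.
[cite: MochizukiFrdI2008, Def. 1.3 (i) p.24] -/
theorem exists_linear_preSteps_of_base_iso (hF : IsFrobenioid F) (A B : C)
    (g : (PreFrobenioidData.ofFunctor Φ F).base.obj A ≅ (PreFrobenioidData.ofFunctor Φ F).base.obj B) :
    ∃ (X : C) (φ : X ⟶ A) (ψ : X ⟶ B), IsIso ((PreFrobenioidData.ofFunctor Φ F).base.map φ) ∧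
      (PreFrobenioidData.ofFunctor Φ F).degFr φ = 1 ∧ (PreFrobenioidData.ofFunctor Φ F).degFr ψ = 1 ∧
      (PreFrobenioidData.ofFunctor Φ F).base.map φ ≫ g.hom = (PreFrobenioidData.ofFunctor Φ F).base.map ψ := by
  obtain ⟨X, φ, ψ, hφ, hψ, h⟩ := hF.i_b A B g
  exact ⟨X, φ, ψ, hφ.2, hφ.1, hψ.1, h⟩

/-- Def. 1.3 (i)(c) with (iv)(b) in operations form: every `f : Y → Base A` is, up to an isomorphism of `Y`,
the base of a pull-back morphism `A' → A`, which is LINEAR. [cite: MochizukiFrdI2008, Def. 1.3 (iv) p.25] -/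
theorem exists_linear_arrow_over_base (hF : IsFrobenioid F) (A : C) {Y : D}
    (f : Y ⟶ (PreFrobenioidData.ofFunctor Φ F).base.obj A) :
    ∃ (A' : C) (φ : A' ⟶ A) (e : (PreFrobenioidData.ofFunctor Φ F).base.obj A' ≅ Y),
      (PreFrobenioidData.ofFunctor Φ F).base.map φ = e.hom ≫ f ∧ (PreFrobenioidData.ofFunctor Φ F).degFr φ = 1 := by
  haveI := hF.i_c A
  let T : Over ((wideSubcategoryInclusion (pullbackMorphisms F) ⋙ baseFunctor F).obj ⟨A⟩) := Over.mk f
  let P := (pullbackSliceToBase F A).objPreimage T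
  let i : (pullbackSliceToBase F A).obj P ≅ T := (pullbackSliceToBase F A).objObjPreimageIso T
  refine ⟨P.left.obj, P.hom.hom,
    (Over.forget ((wideSubcategoryInclusion (pullbackMorphisms F) ⋙ baseFunctor F).obj ⟨A⟩)).mapIso i,
    (Over.w i.hom).symm, (hF.iv_b P.hom.hom P.hom.property).2⟩

/-- Def. 1.3 (ii) in operations form: out of every object there is, for every `n ∈ N_{≥1}`, a morphism of
Frobenius type — in particular a base-isomorphism — of Frobenius degree `n`. [cite: MochizukiFrdI2008, Def. 1.3 (ii) p.24] -/
theorem exists_baseIso_of_degFr (hF : IsFrobenioid F) (A : C) (n : ℕ+) :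
    ∃ (B : C) (γ : A ⟶ B), IsIso ((PreFrobenioidData.ofFunctor Φ F).base.map γ) ∧
      (PreFrobenioidData.ofFunctor Φ F).degFr γ = n := by
  obtain ⟨B, γ, hγ, hn⟩ := hF.ii_exists A n
  exact ⟨B, γ, hγ.2, hn⟩

end OneFrobenioid

section TwoFrobenioids

variable {D₁ : Type u} [Category.{v} D₁] {Φ₁ : D₁ᵒᵖ ⥤ CommMonCat.{w}}
  {C₁ : Type u'} [Category.{v'} C₁] (F₁ : C₁ ⥤ ElemFrobenioid Φ₁)
  {D₂ : Type u} [Category.{v} D₂] {Φ₂ : D₂ᵒᵖ ⥤ CommMonCat.{w}}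
  {C₂ : Type u'} [Category.{v'} C₂] (F₂ : C₂ ⥤ ElemFrobenioid Φ₂)
  (Ψ : C₁ ≌ C₂)

/-- **Corollary 4.11 (ii) for Frobenioids, REDUCED to existence**: if there is an equivalence
`Ψ^Base : D₁ ⥤ D₂` with `Base₂ ∘ Ψ ≅ Ψ^Base ∘ Base₁`, then the typed Cor. 4.11 (ii) holds for `Ψ` — the
`1`-uniqueness ("easily verified", FrdI p. 94) by `BaseSquareUniqueness`, the rigidity for slim bases by
Prop. 1.13 (i) (`RigiditySlimness`). [cite: MochizukiFrdI2008, Cor. 4.11 (ii) p.91] -/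
theorem cor411ii_of_exists_base_equivalence' (hF₁ : IsFrobenioid F₁) (hF₂ : IsFrobenioid F₂)
    (hex : ∃ ΨBase : D₁ ⥤ D₂, ΨBase.IsEquivalence ∧
      OneCommutes Ψ.functor (PreFrobenioidData.ofFunctor Φ₂ F₂).base (PreFrobenioidData.ofFunctor Φ₁ F₁).base ΨBase) :
    (PreFrobenioidData.ofFunctor Φ₁ F₁).Cor411ii (PreFrobenioidData.ofFunctor Φ₂ F₂) Ψ :=
  PreFrobenioidData.cor411ii_of_exists_base_equivalence _ _ Ψ (exists_base_iso_of_isFrobenioid F₁ hF₁)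
    (exists_preSteps_of_base_iso F₁ hF₁) (fun A _ f => exists_arrow_over_base F₁ hF₁ A f) hex
    (fun _ h₂ => IsRigidFunctor.comp_of_isEquivalence Ψ.functor (isRigidFunctor_baseFunctor hF₂ h₂))

/-- **Corollary 4.12 for Frobenioids from a base square**: an equivalence `Ψ^Base` with
`η : Base₂ ∘ Ψ ≅ Ψ^Base ∘ Base₁` and "`Ψ` preserves Frobenius degrees" give the typed Cor. 4.12 for `Ψ`
(`Ψ⁰ := Ψ^Base × id`; `1`-uniqueness by `BaseDegSquare`, rigidity by Prop. 1.13 (i)).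
[cite: MochizukiFrdI2008, Cor. 4.12 p.95] -/
theorem cor412_of_base_square' (hF₁ : IsFrobenioid F₁) (hF₂ : IsFrobenioid F₂)
    (R₁ : (PreFrobenioidData.ofFunctor Φ₁ F₁).RSParams) (R₂ : (PreFrobenioidData.ofFunctor Φ₂ F₂).RSParams)
    (ΨBase : D₁ ⥤ D₂) [ΨBase.IsEquivalence]
    (η : Ψ.functor ⋙ (PreFrobenioidData.ofFunctor Φ₂ F₂).base ≅ (PreFrobenioidData.ofFunctor Φ₁ F₁).base ⋙ ΨBase)
    (hdeg : PreFrobenioidData.PreservesDegFr (PreFrobenioidData.ofFunctor Φ₁ F₁) (PreFrobenioidData.ofFunctor Φ₂ F₂) Ψ) :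
    (PreFrobenioidData.ofFunctor Φ₁ F₁).Cor412 (PreFrobenioidData.ofFunctor Φ₂ F₂) Ψ R₁ R₂ :=
  PreFrobenioidData.cor412_of_base_square _ _ Ψ R₁ R₂ (exists_base_iso_of_isFrobenioid F₁ hF₁)
    (exists_linear_preSteps_of_base_iso F₁ hF₁) (fun A _ f => exists_linear_arrow_over_base F₁ hF₁ A f)
    (exists_baseIso_of_degFr F₁ hF₁) ΨBase η hdeg
    (fun _ h₂ => IsRigidFunctor.comp_of_isEquivalence Ψ.functor (isRigidFunctor_baseFunctor hF₂ h₂))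

/-- **Corollary 4.12 from Corollary 4.11 (ii)** for Frobenioids: under the hypotheses of Cor. 4.11 (Div-slim
bases, standard type, `HypB`) the typed Cor. 4.11 (ii) and "`Ψ` preserves Frobenius degrees" give the
typed Cor. 4.12 (FrdI p. 95: the 1-commutative diagram over `F_{0_{D_i}} = D_i × N_{≥1}` "determined by the
Frobenius degree and the projection to `D_i`"). [cite: MochizukiFrdI2008, Cor. 4.12 p.95] -/
theorem cor412_of_cor411ii (hF₁ : IsFrobenioid F₁) (hF₂ : IsFrobenioid F₂)
    (R₁ : (PreFrobenioidData.ofFunctor Φ₁ F₁).RSParams) (R₂ : (PreFrobenioidData.ofFunctor Φ₂ F₂).RSParams)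
    (h2 : (PreFrobenioidData.ofFunctor Φ₁ F₁).Cor411ii (PreFrobenioidData.ofFunctor Φ₂ F₂) Ψ)
    (hs : (PreFrobenioidData.ofFunctor Φ₁ F₁).Cor411Setting (PreFrobenioidData.ofFunctor Φ₂ F₂) Ψ)
    (hdeg : PreFrobenioidData.PreservesDegFr (PreFrobenioidData.ofFunctor Φ₁ F₁) (PreFrobenioidData.ofFunctor Φ₂ F₂) Ψ) :
    (PreFrobenioidData.ofFunctor Φ₁ F₁).Cor412 (PreFrobenioidData.ofFunctor Φ₂ F₂) Ψ R₁ R₂ := by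
  obtain ⟨ΨBase, ⟨hEq, ⟨η⟩, -⟩, -⟩ := h2 hs
  haveI := hEq
  exact cor412_of_base_square' F₁ F₂ Ψ hF₁ hF₂ R₁ R₂ ΨBase η hdeg

/-- **Corollary 4.11 (iv), rigidity clause** (typed `Cor411ivRigid`, v2: "each of the composite functors
[`C₁ → F_{Φ₂}`] of this diagram is rigid", FrdI p. 92; proof p. 94 "via the same argument as … (i)", i.e.
the Div-slimness argument of p. 93) for Frobenioids, for THE data of a base square compatible with divisors
(`Ψ^Base`, `η : Base₂ ∘ Ψ ≅ Ψ^Base ∘ Base₁`, `Ψ^Φ` on `D₁` with `Div(Ψ φ) = η_A^* Ψ^Φ(Div φ)` — the data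
produced by Cor. 4.11 (ii)–(iv)): both composites are "Div-rigid". The first clause is
`comp_baseFunctor_iso_eq_refl_of_isDivSlim`; the second is transported to the first along `η`.
[cite: MochizukiFrdI2008, Cor. 4.11 (iv) p.94] -/
theorem cor411ivRigid_of_square (hF₂ : IsFrobenioid F₂) (ΨBase : D₁ ⥤ D₂)
    (E : (PreFrobenioidData.ofFunctor Φ₁ F₁).DivisorMonoidIsoOverBase (PreFrobenioidData.ofFunctor Φ₂ F₂) ΨBase)
    (η : Ψ.functor ⋙ (PreFrobenioidData.ofFunctor Φ₂ F₂).base ≅ (PreFrobenioidData.ofFunctor Φ₁ F₁).base ⋙ ΨBase)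
    (hdivE : ∀ ⦃A B : C₁⦄ (φ : A ⟶ B), (PreFrobenioidData.ofFunctor Φ₂ F₂).div (Ψ.functor.map φ) =
      (PreFrobenioidData.ofFunctor Φ₂ F₂).pull (η.hom.app A) (E.iso ((PreFrobenioidData.ofFunctor Φ₁ F₁).base.obj A)
        ((PreFrobenioidData.ofFunctor Φ₁ F₁).div φ))) :
    (PreFrobenioidData.ofFunctor Φ₁ F₁).Cor411ivRigid (PreFrobenioidData.ofFunctor Φ₂ F₂) Ψ ΨBase E := by
  intro hs
  have hds : (PreFrobenioidData.ofFunctor Φ₂ F₂).IsDivSlim := hs.divSlim.2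
  have h1 : ∀ α : Ψ.functor ⋙ (PreFrobenioidData.ofFunctor Φ₂ F₂).base ≅ Ψ.functor ⋙ (PreFrobenioidData.ofFunctor Φ₂ F₂).base,
      (∀ ⦃A B : C₁⦄ (φ : A ⟶ B), (PreFrobenioidData.ofFunctor Φ₂ F₂).pull (α.hom.app A)
          ((PreFrobenioidData.ofFunctor Φ₂ F₂).div (Ψ.functor.map φ)) = (PreFrobenioidData.ofFunctor Φ₂ F₂).div (Ψ.functor.map φ)) →
        α = Iso.refl _ :=
    fun α hα => comp_baseFunctor_iso_eq_refl_of_isDivSlim Ψ hF₂ hds α hα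
  refine ⟨h1, fun α hα => ?_⟩
  -- transport `α` along `η` to an automorphism of `Ψ ⋙ Base₂` fixing divisors
  have h2 : η ≪≫ α ≪≫ η.symm = Iso.refl _ := by
    refine h1 (η ≪≫ α ≪≫ η.symm) fun A B φ => ?_
    rw [Iso.trans_hom, Iso.trans_hom, NatTrans.comp_app, NatTrans.comp_app, Iso.symm_hom,
      (PreFrobenioidData.ofFunctor Φ₂ F₂).pull_comp, (PreFrobenioidData.ofFunctor Φ₂ F₂).pull_comp, hdivE,
      ← (PreFrobenioidData.ofFunctor Φ₂ F₂).pull_comp _ (η.hom.app A), Iso.inv_hom_id_app,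
      (PreFrobenioidData.ofFunctor Φ₂ F₂).pull_id, hα]
  calc α = η.symm ≪≫ (η ≪≫ α ≪≫ η.symm) ≪≫ η := by
        ext X
        simp
    _ = Iso.refl _ := by
        rw [h2]
        ext X
        simp

end TwoFrobenioids

end PreFrobenioid

end Literature.AlgebraicGeometry.Frobenioids
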